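import Literature.MathematicalPhysics.QuantumLattice.ReducedBCSTorus
import Literature.MathematicalPhysics.QuantumLattice.FreeFermionTraceFormulaProofs
import Literature.MathematicalPhysics.QuantumLattice.HubbardWave0RayleighProofs
import HarnessLib

/-!
# The Bogoliubov implementer of a relabelled plane-wave basis on the fermionic torus

Topic `MathematicalPhysics/QuantumLattice`. On the Jordan–Wigner Fock space of the fermionic torus
`(ℤ/Lℤ)^d` (orbitals `Orb (FermionTorus d L)`), the normalised plane waves
`m_{kτ} = L^{-d/2} (planeWave k τ)` form an orthonormal basis of the one-particle space, and the
Bloch modes are the smeared fields `c_{kτ} = a(m_{kτ})`, `c†_{kτ} = a†(m_{kτ})`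
(`momentumAnnihilation`, `momentumCreation` of `ReducedBCSTorus`). For ANY bijective relabelling
`κ : Orb → (ℤ/Lℤ)^d × Fin 2` of the orbitals by momentum–spin labels, the matrix `V_κ` whose
column `o` is the mode `m_{κ o}` is unitary, hence `V_κ = e^{K}` for some `K`
(`exists_exp_eq_coe_unitaryGroup`), and the particle-number conserving Bogoliubov implementer
`W = e^{dΓ(K)}` of `FreeFermionTraceFormulaProofs` / `FermionQuasiFree` transports the position-space
Jordan–Wigner generators onto the Bloch modes:

* `sum_conj_planeWave_mul_planeWave` — orthonormality `⟨m_{kτ}, m_{k'τ'}⟩ = δ_{kk'} δ_{ττ'}`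
  (read off from the two forms of the mixed CAR, `annihilate_mul_create_add` and
  `momentumAnnihilation_mul_momentumCreation_add`);
* `exists_bogoliubov_implementer_of_orthonormal` — for ANY finite orbital set and any matrix `V`
  with orthonormal columns: `W, W'` with `W'W = WW' = 1`, `W c_o W' = a(V e_o)`,
  `W c†_o W' = a†(V e_o)` (`W = e^{dΓ(K)}`, `e^K = V`);
* **`exists_bogoliubov_implementer`** — there are matrices `W, W'` on Fock space with `W' W = 1`,
  `W W' = 1`, `W c_o W' = c_{κ o}` and `W c†_o W' = c†_{κ o}` for every orbital `o` (`c_{(k,τ)}` the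
  Bloch annihilator); consequently `W (c_o c_{o'}) W' = c_{κ o} c_{κ o'}` etc., and
  `Tr e^{-β W X W'} = Tr e^{-βX}` (`partitionFn_conj_of_mul_eq_one`).

This is the change of one-particle basis "`Γ(U) dΓ(A) Γ(U)⋆ = dΓ(UAU⋆)`" (Bratteli–Robinson II
§5.2.1; Dereziński–Gérard §17.2.4) in the form needed to map quadratic — not necessarily
number-conserving — momentum-space Hamiltonians (BCS/BdG pairing between `(k↑)` and `(-k↓)`)
onto sums of ON-SITE blocks in position space, where the trace factorises
(`FermionTraceFactorization`). Everything is proved; no definition and no named fact.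

## Mathlib / tree search

Tree: `momentumAnnihilation_eq_sum_planeWave`, `momentumCreation_eq_sum_planeWave`,
`momentumAnnihilation_mul_momentumCreation_add` (`ReducedBCSTorus`); `RayleighBound.annihilate`,
`create`, `annihilate_mul_create_add` (`HubbardWave0RayleighProofs`);
`exp_dGamma_mul_creation_mul_exp_neg`, `exp_dGamma_mul_annihilation_mul_exp_neg` (`FermionQuasiFree`);
`exists_exp_eq_coe_unitaryGroup` (`FreeFermionTraceFormulaProofs`). Mathlib:
`Matrix.mem_unitaryGroup_iff'`, `Matrix.inv_eq_left_inv`, `Matrix.exp_neg`, `Matrix.exp_conj`,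
`Matrix.trace_mul_cycle`.

## References

* O. Bratteli, D. W. Robinson, *Operator Algebras and Quantum Statistical Mechanics 2*, 2nd ed.
  (Springer 1997), §5.2.1–5.2.2. [BratteliRobinsonII1997]
* J. Dereziński, C. Gérard, *Mathematics of Quantization and Quantum Fields* (CUP 2013/2022),
  §17.2.4. [DerezinskiGerard2022]
-/

noncomputable section

namespace Literature.MathematicalPhysics.QuantumLattice

open Matrix Finset NormedSpace Literature.Probability.LatticeModels
open scoped ComplexConjugate

variable {d L : ℕ} [NeZero L]

/-! ### Bloch modes as smeared fields; orthonormality of the normalised plane waves -/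

/-- `c_{kτ} = a(m_{kτ})` with `m_{kτ} = L^{-d/2} planeWave k τ`. [folklore] -/
theorem momentumAnnihilation_eq_annihilate (k : TorusSite d L) (τ : Fin 2) :
    momentumAnnihilation k τ =
      RayleighBound.annihilate (fun o => torusFourierWeight d L * planeWave k τ o) := by
  rw [momentumAnnihilation_eq_sum_planeWave, RayleighBound.annihilate]
  refine Finset.sum_congr rfl fun o _ => ?_
  rw [star_mul', star_torusFourierWeight, Complex.star_def]

/-- `c†_{kτ} = a†(m_{kτ})`. [folklore] -/
theorem momentumCreation_eq_create (k : TorusSite d L) (τ : Fin 2) :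
    momentumCreation k τ = RayleighBound.create (fun o => torusFourierWeight d L * planeWave k τ o) := by
  rw [momentumCreation_eq_sum_planeWave, RayleighBound.create]

/-- **Orthonormality of the normalised plane waves**:
`Σ_o conj(L^{-d/2} planeWave k τ o) · (L^{-d/2} planeWave k' τ' o) = δ_{kk'} δ_{ττ'}`.
[cite: BratteliRobinsonII1997, §5.2.1 (a(f), a†(g) with {a(f),a†(g)} = ⟨f,g⟩)] -/
theorem sum_conj_planeWave_mul_planeWave (k k' : TorusSite d L) (τ τ' : Fin 2) :
    ∑ o : Orb (FermionTorus d L), star (torusFourierWeight d L * planeWave k τ o) *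
        (torusFourierWeight d L * planeWave k' τ' o) =
      if k = k' ∧ τ = τ' then 1 else 0 := by
  have h1 := RayleighBound.annihilate_mul_create_add
    (fun o => torusFourierWeight d L * planeWave k τ o) (fun o => torusFourierWeight d L * planeWave k' τ' o)
  rw [← momentumAnnihilation_eq_annihilate, ← momentumCreation_eq_create,
    momentumAnnihilation_mul_momentumCreation_add] at h1
  have h2 := congrFun (congrFun h1 ∅) ∅
  simp only [Matrix.smul_apply, Matrix.one_apply_eq, smul_eq_mul, mul_one, dotProduct, Pi.star_apply] at h2
  rw [← h2]
  split_ifs <;> simp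

/-! ### The Bogoliubov implementer of an orthonormal one-particle basis (general orbital set) -/

section General

variable {ι : Type*} [LinearOrder ι] [Fintype ι]

/-- Conjugation by an invertible pair is multiplicative. [folklore] -/
theorem conj_mul_of_mul_eq_one {n : Type*} [Fintype n] [DecidableEq n] {E E' : Matrix n n ℂ}
    (h : E' * E = 1) (X Y : Matrix n n ℂ) :
    E * (X * Y) * E' = E * X * E' * (E * Y * E') := by
  calc E * (X * Y) * E' = E * X * (E' * E) * Y * E' := by rw [h]; noncomm_ring
    _ = E * X * E' * (E * Y * E') := by noncomm_ring

/-- **The Bogoliubov implementer of an orthonormal basis.** If the columns of `V : Matrix ι ι ℂ`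
are orthonormal, there are Fock-space matrices `W, W'` with `W'W = WW' = 1`,
`W c_o W' = Σ_{o'} conj(V_{o'o}) c_{o'} = a(V e_o)` and `W c†_o W' = Σ_{o'} V_{o'o} c†_{o'} = a†(V e_o)`
(`W = e^{dΓ(K)}` for any `K` with `e^{K} = V`, `exists_exp_eq_coe_unitaryGroup`).
[cite: BratteliRobinsonII1997, §5.2.2 (Bogoliubov transformations implemented by Γ(U))] -/
theorem exists_bogoliubov_implementer_of_orthonormal (V : Matrix ι ι ℂ)
    (hdiag : ∀ o : ι, ∑ o', star (V o' o) * V o' o = 1)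
    (hoff : ∀ o₁ o₂ : ι, o₁ ≠ o₂ → ∑ o', star (V o' o₁) * V o' o₂ = 0) :
    ∃ W W' : Matrix (Finset ι) (Finset ι) ℂ, W' * W = 1 ∧ W * W' = 1 ∧
      (∀ o, W * annihilation o * W' = ∑ o', star (V o' o) • annihilation o') ∧
      (∀ o, W * creation o * W' = ∑ o', V o' o • creation o') := by
  have hVV : Vᴴ * V = 1 := by
    ext o₁ o₂
    rw [Matrix.mul_apply, Matrix.one_apply]
    by_cases h : o₁ = o₂
    · subst h
      rw [if_pos rfl, ← hdiag o₁]
      rfl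
    · rw [if_neg h, ← hoff o₁ o₂ h]
      rfl
  obtain ⟨K, hK⟩ := exists_exp_eq_coe_unitaryGroup ⟨V, Matrix.mem_unitaryGroup_iff'.2 hVV⟩
  simp only at hK
  refine ⟨exp (dGamma K), exp (-(dGamma K)), ?_, ?_, ?_, ?_⟩
  · rw [← Matrix.exp_add_of_commute _ _ (Commute.refl (dGamma K)).neg_left, neg_add_cancel, exp_zero]
  · rw [← Matrix.exp_add_of_commute _ _ (Commute.refl (dGamma K)).neg_right, add_neg_cancel, exp_zero]
  · intro o
    have h := exp_dGamma_mul_annihilation_mul_exp_neg K 1 o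
    rw [one_smul, one_smul] at h
    rw [h]
    have hinv : exp (-K) = Vᴴ := by
      rw [Matrix.exp_neg, hK]
      exact Matrix.inv_eq_left_inv hVV
    refine Finset.sum_congr rfl fun o' _ => ?_
    rw [hinv, conjTranspose_apply]
  · intro o
    have h := exp_dGamma_mul_creation_mul_exp_neg K 1 o
    rw [one_smul, one_smul] at h
    rw [h, hK]

end General

/-! ### The implementer of a relabelling of the orbitals by Bloch modes -/

/-- **Existence of the Bogoliubov implementer of a relabelling by Bloch modes.** For an
injective `κ : Orb → (ℤ/Lℤ)^d × Fin 2` there are Fock-space matrices `W, W'` with `W'W = WW' = 1`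
such that `W c_o W' = c_{κ o}` and `W c†_o W' = c†_{κ o}` for every orbital `o`, the right-hand
sides being the Bloch annihilator/creator of the momentum–spin label `κ o` (the columns `m_{κ o}`
of the mode matrix are orthonormal). [cite: BratteliRobinsonII1997, §5.2.2 (Bogoliubov transformations implemented by Γ(U))] -/
theorem exists_bogoliubov_implementer (κ : Orb (FermionTorus d L) → TorusSite d L × Fin 2)
    (hκ : Function.Injective κ) :
    ∃ W W' : Matrix (Finset (Orb (FermionTorus d L))) (Finset (Orb (FermionTorus d L))) ℂ,
      W' * W = 1 ∧ W * W' = 1 ∧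
      (∀ o, W * annihilation o * W' = momentumAnnihilation (κ o).1 (κ o).2) ∧
      (∀ o, W * creation o * W' = momentumCreation (κ o).1 (κ o).2) := by
  have hdiag : ∀ o : Orb (FermionTorus d L),
      ∑ o', star ((Matrix.of fun o' o : Orb (FermionTorus d L) =>
          torusFourierWeight d L * planeWave (κ o).1 (κ o).2 o') o' o) *
        (Matrix.of fun o' o : Orb (FermionTorus d L) =>
          torusFourierWeight d L * planeWave (κ o).1 (κ o).2 o') o' o = 1 := by
    intro o
    have h := sum_conj_planeWave_mul_planeWave (κ o).1 (κ o).1 (κ o).2 (κ o).2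
    rw [if_pos ⟨rfl, rfl⟩] at h
    simpa only [Matrix.of_apply] using h
  have hoff : ∀ o₁ o₂ : Orb (FermionTorus d L), o₁ ≠ o₂ →
      ∑ o', star ((Matrix.of fun o' o : Orb (FermionTorus d L) =>
          torusFourierWeight d L * planeWave (κ o).1 (κ o).2 o') o' o₁) *
        (Matrix.of fun o' o : Orb (FermionTorus d L) =>
          torusFourierWeight d L * planeWave (κ o).1 (κ o).2 o') o' o₂ = 0 := by
    intro o₁ o₂ h12
    have h := sum_conj_planeWave_mul_planeWave (κ o₁).1 (κ o₂).1 (κ o₁).2 (κ o₂).2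
    have h' : ¬ ((κ o₁).1 = (κ o₂).1 ∧ (κ o₁).2 = (κ o₂).2) := fun hh =>
      h12 (hκ (Prod.ext hh.1 hh.2))
    rw [if_neg h'] at h
    simpa only [Matrix.of_apply] using h
  obtain ⟨W, W', h1, h2, h3, h4⟩ := exists_bogoliubov_implementer_of_orthonormal
    (Matrix.of fun o' o : Orb (FermionTorus d L) => torusFourierWeight d L * planeWave (κ o).1 (κ o).2 o')
    hdiag hoff
  refine ⟨W, W', ?_, ?_, fun o => ?_, fun o => ?_⟩
  · -- the two `DecidableEq` paths on `Orb (FermionTorus d L)` (generic vs `Lex`) meet here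
    convert h1
  · convert h2
  · rw [h3 o, momentumAnnihilation_eq_sum_planeWave]
    refine Finset.sum_congr rfl fun o' _ => ?_
    rw [Matrix.of_apply, star_mul', star_torusFourierWeight, Complex.star_def]
  · rw [h4 o, momentumCreation_eq_sum_planeWave]
    refine Finset.sum_congr rfl fun o' _ => ?_
    rw [Matrix.of_apply]

/-- **Similar Hamiltonians have the same partition function**: if `W'W = 1` then
`Tr e^{-β W X W'} = Tr e^{-βX}`. [folklore] -/
theorem partitionFn_conj_of_mul_eq_one {n : Type*} [Fintype n] [DecidableEq n] {W W' : Matrix n n ℂ}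
    (h : W' * W = 1) (β : ℝ) (X : Matrix n n ℂ) :
    partitionFn β (W * X * W') = partitionFn β X := by
  have hW : IsUnit W := (Matrix.isUnit_iff_isUnit_det W).2
    (Matrix.isUnit_det_of_left_inverse h)
  have hW' : W' = W⁻¹ := (Matrix.inv_eq_left_inv h).symm
  rw [partitionFn, partitionFn, gibbsWeight, gibbsWeight, hW', ← Matrix.smul_mul, ← Matrix.mul_smul,
    Matrix.exp_conj _ _ hW, Matrix.trace_mul_cycle, Matrix.nonsing_inv_mul _
      ((Matrix.isUnit_iff_isUnit_det W).1 hW), Matrix.one_mul]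

end Literature.MathematicalPhysics.QuantumLattice
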